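import Summits.BirchSwinnertonDyer.BirchSwinnertonDyer.Theorems.ResidualThetaTransportAtTwoResidualSignedLambdaLowerCMAtTwoFourTermDuality
import Summits.BirchSwinnertonDyer.BirchSwinnertonDyer.Theorems.EisensteinPrimesSelmerAcQuotientCorankLeGeneric
import HarnessLib

/-!
# Sketch (stub-ideation k2·g7) — `stub_cmLambdaLower` / RSL_g: the flank `hPT` retyped against the
# INTRINSIC fine Selmer group, with the λ-bookkeeping lemmas that absorb Kato's «exact up to ×2» at p = 2

Seat `planner-sidea-stub_cmLambdaLower-2-g7`, crux (R≥)ᵖ `ResidualThetaCountLowerPureAtTwo`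
(stmt-BirchSwinnertonDyer-26074), line «bt26-lambda», stub S2 `stub_cmLambdaLower` (= RSL_g, stmt-…-22608).
HONEST FRAMING: helper lemmas + one definition-free `AddSubgroup` (`fineSel`); nothing here proves the stub,
the crux, or BSD. Everything elaborates with NO `sorry`.

* §1 `finrank_baseChange_le_add_of_smul_ker_subset_range` (+ flank form): a three-term complex
  `X →f H →g L` with `ker g ⊆ range f` UP TO NON-ZERO MULTIPLES gives `λ_K(H) ≤ λ_K(X) + λ_K(L)` —
  the kernel-side shape of Kato's (14.9.1)/(17.13.1) «exact upto ×2 in the case p = 2».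
* §2 `finrank_baseChange_characterModule_le_of_injective` / `_mono` / `hPT_of_le`: Pontryagin–λ is
  antitone, so the N5 slot `hPT : λ(H2) ≤ λ(Sel₀⋆)` for ANY `Sel₀ ⊇ N` follows from the flank against `N`.
* §3 `fineSel` (awayKer at every finite place, infKer at every infinite place, all conjugates),
  `mem_fineSel_iff`, `fineSel_le_unramifiedOutside` (clause 1 of `fineSel ≤ Sg`, any `S₀`, any `p`),
  `scalarH1_mem_fineSel` (`𝒪`-stability, by the tree's `scalarH1_mem_awayKer` / `scalarH1_mem_infKer`).
* §4 `FlankFineClause` (the HOLD clause shape) and `planA_wiring` (the N5-decorated interface consumed with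
  `Sel₀ := N`, `hPT :=` the clause — i.e. S5 is no longer a kernel stub).
-/

set_option autoImplicit false
set_option linter.dupNamespace false

noncomputable section

open scoped TensorProduct Classical
open NumberField IsDedekindDomain Field
open Literature.NumberTheory.EllipticCurves Literature.NumberTheory.EllipticCurves.GreenbergSelmer
  Literature.NumberTheory.EllipticCurves.GreenbergVatsal2000
  Literature.NumberTheory.GaloisRepresentations

universe u v w

namespace Summit.BirchSwinnertonDyer.BirchSwinnertonDyer.Cruxes.ResidualThetaCountLowerPureAtTwo.SideaK2G7

/-! ### §1 λ-bookkeeping for a three-term sequence exact up to bounded torsion -/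

section ThreeTerm

variable {A : Type u} [CommRing A] (K : Type w) [Field K] [Algebra A K] [IsFractionRing A K]
  {X H L : Type v} [AddCommGroup X] [Module A X] [AddCommGroup H] [Module A H]
  [AddCommGroup L] [Module A L]

/-- **H1.** `X →f H →g L` with every element of `ker g` having a non-zero multiple in `range f`
(«exact up to ×c») gives `λ_K(H) ≤ λ_K(X) + λ_K(L)`, `λ_K = dim_K (K ⊗_A ·)`, `K = Frac A`. [folklore] -/
theorem finrank_baseChange_le_add_of_smul_ker_subset_range (f : X →ₗ[A] H) (g : H →ₗ[A] L)
    (hex : ∀ h ∈ LinearMap.ker g, ∃ a : A, a ≠ 0 ∧ a • h ∈ LinearMap.range f)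
    [Module.Finite K (K ⊗[A] X)] [Module.Finite K (K ⊗[A] H)] [Module.Finite K (K ⊗[A] L)] :
    Module.finrank K (K ⊗[A] H) ≤ Module.finrank K (K ⊗[A] X) + Module.finrank K (K ⊗[A] L) := by
  have hker : LinearMap.ker (g.baseChange K) ≤ LinearMap.range (f.baseChange K) :=
    Summit.BirchSwinnertonDyer.BirchSwinnertonDyer.Theorems.CharIdealLambda.ker_baseChange_le_range_baseChange_of_smul_mem_range
      K f g hex
  have h1 := (g.baseChange K).finrank_range_add_finrank_ker
  have h2 : Module.finrank K (LinearMap.ker (g.baseChange K)) ≤ Module.finrank K (K ⊗[A] X) :=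
    (Submodule.finrank_mono hker).trans (f.baseChange K).finrank_range_le
  have h3 : Module.finrank K (LinearMap.range (g.baseChange K)) ≤ Module.finrank K (K ⊗[A] L) :=
    Submodule.finrank_le _
  omega

/-- **H1′ (flank form).** If moreover `λ_K(L) = 0` (e.g. `L = 𝐇²_loc`, Pontryagin dual of
`A_g(ℚ_{∞,2})[2^∞] = 0`), then `λ_K(H) ≤ λ_K(X)`. [folklore] -/
theorem finrank_baseChange_le_of_smul_ker_subset_range_of_finrank_eq_zero (f : X →ₗ[A] H)
    (g : H →ₗ[A] L) (hex : ∀ h ∈ LinearMap.ker g, ∃ a : A, a ≠ 0 ∧ a • h ∈ LinearMap.range f)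
    [Module.Finite K (K ⊗[A] X)] [Module.Finite K (K ⊗[A] H)] [Module.Finite K (K ⊗[A] L)]
    (hL : Module.finrank K (K ⊗[A] L) = 0) :
    Module.finrank K (K ⊗[A] H) ≤ Module.finrank K (K ⊗[A] X) := by
  have := finrank_baseChange_le_add_of_smul_ker_subset_range K f g hex
  omega

/-- **H1″ (fixed exponent).** The «×c» version: one non-zero `c` (e.g. `c = 2 ^ m`) kills `ker g / range f`. [folklore] -/
theorem finrank_baseChange_le_add_of_const_smul_ker_subset_range (f : X →ₗ[A] H) (g : H →ₗ[A] L)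
    {c : A} (hc : c ≠ 0) (hex : ∀ h ∈ LinearMap.ker g, c • h ∈ LinearMap.range f)
    [Module.Finite K (K ⊗[A] X)] [Module.Finite K (K ⊗[A] H)] [Module.Finite K (K ⊗[A] L)] :
    Module.finrank K (K ⊗[A] H) ≤ Module.finrank K (K ⊗[A] X) + Module.finrank K (K ⊗[A] L) :=
  finrank_baseChange_le_add_of_smul_ker_subset_range K f g fun h hh ↦ ⟨c, hc, hex h hh⟩

end ThreeTerm

/-! ### §2 Pontryagin–λ is antitone: the N5 slot `hPT` from the flank against a SMALLER subgroup -/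

section Antitone

variable {A : Type u} [CommRing A] (K : Type w) [Field K] [Algebra A K]
  {N M : Type v} [AddCommGroup N] [Module A N] [AddCommGroup M] [Module A M]

/-- **H2.** An injection `N ↪ M` gives `M⋆ ↠ N⋆` (`ℚ/ℤ` injective), hence `λ_K(N⋆) ≤ λ_K(M⋆)`
(and `K ⊗ N⋆` is finite-dimensional as soon as `K ⊗ M⋆` is). [folklore] -/
theorem finrank_baseChange_characterModule_le_of_injective (i : N →ₗ[A] M)
    (hi : Function.Injective i) [Module.Finite K (K ⊗[A] CharacterModule M)] :
    Module.finrank K (K ⊗[A] CharacterModule N) ≤ Module.finrank K (K ⊗[A] CharacterModule M) := by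
  have hs : Function.Surjective (CharacterModule.dual i) :=
    CharacterModule.dual_surjective_of_injective _ hi
  have hs' : Function.Surjective ((CharacterModule.dual i).baseChange K) := by
    rw [LinearMap.baseChange_eq_ltensor]
    exact LinearMap.lTensor_surjective K hs
  haveI : Module.Finite K (K ⊗[A] CharacterModule N) := Module.Finite.of_surjective _ hs'
  have h := ((CharacterModule.dual i).baseChange K).finrank_range_le
  rwa [LinearMap.range_eq_top.mpr hs', finrank_top] at h

/-- **H2′.** Submodule form: `N ≤ M ≤ S` ⇒ `λ_K(N⋆) ≤ λ_K(M⋆)`. [folklore] -/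
theorem finrank_baseChange_characterModule_mono {S : Type v} [AddCommGroup S] [Module A S]
    {N' M' : Submodule A S} (hle : N' ≤ M') [Module.Finite K (K ⊗[A] CharacterModule M')] :
    Module.finrank K (K ⊗[A] CharacterModule N') ≤ Module.finrank K (K ⊗[A] CharacterModule M') :=
  finrank_baseChange_characterModule_le_of_injective K (Submodule.inclusion hle)
    (Submodule.inclusion_injective hle)

/-- **H3 (`hPT` of the N5-decorated interface from the fine flank).** For ANY strict choice
`Sel₀ ⊇ N` (e.g. `Sel₀ = Fine(Sg) = ker res`, `N = fineSel`): `λ(H2) ≤ λ(N⋆) ⇒ λ(H2) ≤ λ(Sel₀⋆)`. [folklore] -/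
theorem hPT_of_le {S : Type v} [AddCommGroup S] [Module A S] {H2 : Type v} [AddCommGroup H2]
    [Module A H2] {N' Sel₀ : Submodule A S} (hle : N' ≤ Sel₀)
    [Module.Finite K (K ⊗[A] CharacterModule Sel₀)]
    (hflank : Module.finrank K (K ⊗[A] H2) ≤ Module.finrank K (K ⊗[A] CharacterModule N')) :
    Module.finrank K (K ⊗[A] H2) ≤ Module.finrank K (K ⊗[A] CharacterModule Sel₀) :=
  hflank.trans (finrank_baseChange_characterModule_mono K hle)

end Antitone

/-! ### §3 The intrinsic fine Selmer group (everywhere locally trivial classes, all conjugates) -/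

section FineSelmer

variable {k : Type u} [Field k] [NumberField k] (H : Subgroup (absoluteGaloisGroup k)) [H.Normal]
  (M : Type u) [AddCommGroup M] [DistribMulAction (absoluteGaloisGroup k) M] [TopologicalSpace M]
  [DiscreteTopology M]

/-- **D1 `fineSel`.** The FINE (everywhere locally trivial) Selmer group of the discrete `Γ_k`-module
`M` over `L = k̄^H`: classes whose every conjugate dies on `H ⊓ D_v` for every finite `v` (`awayKer`)
and on `H ⊓ D_w` for every infinite `w` (`infKer`). No `S₀`, no `p`, no local datum: it is contained in
every Greenberg-type Selmer group of `M` over `L`. (Coates–Sujatha's `R`, Lei–Lim's `Sel₀`,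
Kato's strict `H¹`: same λ over `ℚ_∞`, see the card's dictionary.) [folklore] -/
def fineSel : AddSubgroup (subgroupH1 H M) :=
  (⨅ (v : HeightOneSpectrum (𝓞 k)) (σ : absoluteGaloisGroup k), (awayKer H M v).comap (conjH1 H M σ)) ⊓
    ⨅ (w : InfinitePlace k) (σ : absoluteGaloisGroup k), (infKer H M w).comap (conjH1 H M σ)

variable {H M} in
/-- Membership in `fineSel`. [folklore] -/
theorem mem_fineSel_iff (c : subgroupH1 H M) :
    c ∈ fineSel H M ↔
      (∀ (v : HeightOneSpectrum (𝓞 k)) (σ : absoluteGaloisGroup k), conjH1 H M σ c ∈ awayKer H M v) ∧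
        ∀ (w : InfinitePlace k) (σ : absoluteGaloisGroup k), conjH1 H M σ c ∈ infKer H M w := by
  simp only [fineSel, AddSubgroup.mem_inf, AddSubgroup.mem_iInf, AddSubgroup.mem_comap]

/-- **H4 (clause 1 of `fineSel ≤ Sg`).** Fine classes are unramified outside ANY `S₀` away from ANY `p`
(`awayKer ≤ unramifiedKer`: a class dying on `H ⊓ D_v` dies on `H ⊓ I_v`). [folklore] -/
theorem fineSel_le_unramifiedOutside (p : ℕ) (S₀ : Set (HeightOneSpectrum (𝓞 k))) :
    fineSel H M ≤ unramifiedOutside H M p S₀ := by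
  intro c hc
  rw [mem_unramifiedOutside_iff]
  intro v _ _ σ
  exact Summit.BirchSwinnertonDyer.BirchSwinnertonDyer.Theorems.SelmerAcQuotientCorankLeGeneric.awayKer_le_unramifiedKer
    H M v (((mem_fineSel_iff c).1 hc).1 v σ)

/-- **H4′ (clause 2 of `fineSel ≤ Sg`).** The archimedean clause of S2 is literally the second half of
`fineSel`. [folklore] -/
theorem forall_conjH1_mem_infKer_of_mem_fineSel {c : subgroupH1 H M} (hc : c ∈ fineSel H M)
    (w : InfinitePlace k) (σ : absoluteGaloisGroup k) : conjH1 H M σ c ∈ infKer H M w :=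
  ((mem_fineSel_iff c).1 hc).2 w σ

/-- **H6 (`𝒪`-module structure).** `fineSel` is stable under every scalar of `M` commuting with `Γ_k`
(so for `M = A_g = Cofree ρ K_ι` it is an `𝒪`-, indeed `Λ_𝒪`-module like `Sg`; cf. p667294 §1).
[cite: EmertonPollackWeston2006, §3.1] -/
theorem scalarH1_mem_fineSel {R : Type*} [Monoid R] [DistribMulAction R M]
    [SMulCommClass (absoluteGaloisGroup k) R M] (r : R) {c : subgroupH1 H M} (hc : c ∈ fineSel H M) :
    scalarH1 H M r c ∈ fineSel H M := by
  have e : ∀ σ : absoluteGaloisGroup k,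
      conjH1 H M σ (scalarH1 H M r c) = scalarH1 H M r (conjH1 H M σ c) :=
    fun σ ↦ by rw [← AddMonoidHom.comp_apply, conjH1_comp_scalarH1, AddMonoidHom.comp_apply]
  rw [mem_fineSel_iff] at hc ⊢
  refine ⟨fun v σ ↦ ?_, fun w σ ↦ ?_⟩
  · rw [e]; exact scalarH1_mem_awayKer H M v r (hc.1 v σ)
  · rw [e]; exact scalarH1_mem_infKer H M w r (hc.2 w σ)

/-- **H5.** `fineSel` sits inside Greenberg's STRICT Selmer group away from `p` and at infinity, for
every ordinary datum `L` (the clauses at `v ∣ p` are the datum's; `fineSel`'s are stronger). [folklore] -/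
theorem mem_fineSel_awayClauses {p : ℕ} {c : subgroupH1 H M} (hc : c ∈ fineSel H M) :
    (∀ (v : HeightOneSpectrum (𝓞 k)), ((p : ℕ) : 𝓞 k) ∉ v.asIdeal →
        ∀ σ : absoluteGaloisGroup k, conjH1 H M σ c ∈ awayKer H M v) ∧
      ∀ (w : InfinitePlace k) (σ : absoluteGaloisGroup k), conjH1 H M σ c ∈ infKer H M w :=
  ⟨fun v _ σ ↦ ((mem_fineSel_iff c).1 hc).1 v σ, ((mem_fineSel_iff c).1 hc).2⟩

end FineSelmer

/-! ### §4 The HOLD clause shape and the N5 wiring (S5 is consumed as a HYPOTHESIS, not a stub) -/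

section Wiring

/-- **D2 (flank clause shape).** «`λ_K(H2) ≤ λ_K(X⋆)`» — with `H2 := K.H2` (the package's `𝐇²_Γ(T_ρ)`)
and `X := fineSel κ.kerSubgroup (Cofree ρ K_ι)` made an `𝒪`-module by `scalarH1` (H6), this is the
third HOLD clause (iii)_fine of the card: Kato (14.9.1)/(17.13.1) at `p = 2` + `𝐇²_loc = 0`. [folklore] -/
def FlankFineClause (A : Type u) [CommRing A] (K : Type w) [Field K] [Algebra A K]
    (H2 : Type v) [AddCommGroup H2] [Module A H2] (X : Type v) [AddCommGroup X] [Module A X] : Prop :=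
  Module.finrank K (K ⊗[A] H2) ≤ Module.finrank K (K ⊗[A] CharacterModule X)

variable {A : Type u} [CommRing A] (K : Type w) [Field K] [Algebra A K] [IsFractionRing A K]
  {Sel : Type v} [AddCommGroup Sel] [Module A Sel] {P : Type v} [AddCommGroup P] [Module A P]
  {H : Type v} [AddCommGroup H] [Module A H] {H2 : Type v} [AddCommGroup H2] [Module A H2]

/-- **H7 (PLAN A wiring, certifies the slot types).** The landed N5-decorated interface
(`…CharIdealLambda.le_finrank_baseChange_characterModule_of_duality_decorated`, p664041) consumed with
`Sel := Sg`, `Sel₀ := N` (the image of `fineSel` in `Sg`, or `Fine(Sg)` via `hPT_of_le`) and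
`hPT := FlankFineClause A K H2 N` — no kernel theorem about `H2` is needed. [folklore] -/
theorem planA_wiring (pair : P →ₗ[A] CharacterModule Sel) (locd : H →ₗ[A] P) (Z : Submodule A H)
    (N : Submodule A Sel) (hEH : ∀ z ∈ Z, pair (locd z) = 0) (horth : ∀ s ∈ N, ∀ z : P, pair z s = 0)
    (hDH : ∀ z : P, pair z = 0 → ∃ a : A, a ≠ 0 ∧ ∃ x : H, a • z = locd x)
    [Module.Finite K (K ⊗[A] (H ⧸ Z))] [Module.Finite K (K ⊗[A] (P ⧸ Z.map locd))]
    [Module.Finite K (K ⊗[A] CharacterModule Sel)] {d e : ℕ}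
    (hi : d + e ≤ Module.finrank K (K ⊗[A] (P ⧸ Z.map locd)))
    (hii : Module.finrank K (K ⊗[A] (H ⧸ Z)) ≤ Module.finrank K (K ⊗[A] H2) + e)
    (hflank : FlankFineClause A K H2 N) :
    d ≤ Module.finrank K (K ⊗[A] CharacterModule Sel) :=
  Summit.BirchSwinnertonDyer.BirchSwinnertonDyer.Theorems.CharIdealLambda.le_finrank_baseChange_characterModule_of_duality_decorated
    K pair locd Z N hEH horth hDH hi hii hflank

end Wiring

end Summit.BirchSwinnertonDyer.BirchSwinnertonDyer.Cruxes.ResidualThetaCountLowerPureAtTwo.SideaK2G7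

end
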